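import Summits.QuantumFields.BalabanUV.Beta.SecondOrderContactMmRead
import Summits.QuantumFields.BalabanUV.Beta.SpineRecursiveClosed

/-!
# `BalabanUV.Beta.SecondOrderStepEval` — binder row D1, (L4) piece (W-E) EVALUATION, part 3a: **THE REFLECTION LAW OF THE NEXT LEVEL'S
# FIELD–FIELD SECOND-ORDER TABLE, EVALUATED** — transport (`SecondOrderStepTransport.mmRead_K3OfK_bref_sharp`) followed by the closed form of
# `K3OfK(♯) − K3OfK` read through `mmRead` (`SecondOrderContactMmRead.mmRead_K3OfK_sharp_split`)
# (β sub-cell, row BETA-an2 = BINDER-OWNERS row D1 OWNER, lineage an2 gen 18)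

HONEST FRAMING (cell charter, verbatim): «discharging BetaPertH makes Balaban's UV stability UNCONDITIONAL — a real
constructive-QFT result; it is NOT the continuum limit and NOT the Clay problem.»  Neutral kernel algebra ([folklore]); no statement of
Bałaban's papers, no `[cite:]`, no `def`, no `Prop` fact; instantiates no binder of the wall.  NOT D1, NOT `BetaPertH`, NOT continuum, NOT Clay.

## What is here

**`mmRead_K3OfK_bref_sharp_split`** — for a spread, reflection-invariant packed kernel `K` with `RelInv K 𝕄 E` (`𝕄`, `E` spread); first-order
tables `S`, `M` with the sharp laws `S κ (bref u) = ε • refK (S κ u + conjV 𝕄 (diagK (g κ u)))`, `M ρ (bref w) = ε • refK (M ρ w)`; a second-order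
table `W` whose sharp law has a ♯-bi-table OF SIMILARITY SHAPE UP TO A REMAINDER,
`W μ (bref y) ν (bref y′) = (ε ε) • refK (W μ y ν y′ + conjW 𝕄 (dM b) (dM c) (diagK (G b)) (diagK (G c)) (diagK (h b c)) + R b c)`
(`G b` = `g` dressed by `colH K N b`); and the entrywise summabilities / localisations / `E`-commutations of the two landed inputs:
`mmRead N (K3OfK K N S M W μ (bref y) ν (bref y′))
   = (ε_μ ε_ν) • refK (Φ N′ α) ( mmRead N (K3OfK K N S M W μ y ν y′)
       + conjW (mmRead N K) (mmRead N (K2OfK … b)) (mmRead N (K2OfK … c)) (diagK (mmSym N (G b))) (diagK (mmSym N (G c))) (diagK (mmSym N (h b c)))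
       − mmRead N (K ∘ R b c ∘ K) )`.
READING (row D1, hR W-side): with `K := G_j`, `𝕄 := bhKStepAt j`, `(S, M, W) := (SpureRecAt j, M1At j, WrecAt j)` this is the reflection law of
the field–field sector `e4OfKW Lc G_j … = mmRead Lc (K3OfK G_j Lc …)` of `T2RecAt (j+1)` (`SpineRecursiveW`), EVALUATED: a contact of similarity
shape against `mmRead Lc G_j = (wVH (j+1))⁻¹ ·ff bhKStepAt (j+1)` with first-order letters `mmRead Lc (K2OfK …) = e3OfK Lc G_j (SrecAt j)`
(`mmRead_K2OfK_eq_e3OfK` + leaf-10's (c1) fold) and coarse generators `mmSym Lc (G b) =f= (γ_j/(stepScale j·Lc⁴)) · ctGen` (`mmSym_dressedGen_inl`),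
minus the transported remainder.  **`mmRead_K3OfK_stepProp_bref`**: THE SAME SPECIALISED TO THE WALL'S LEVEL-`j` PROPAGATOR (`d + 1 = 4`, odd `Lc`,
centred root): `K := G_j = coDressKBmAt ρ_c Lc (KInvStep Lc j)`, `𝕄 := bhKStepAt 3 ρ_c Lc j`, `E := axEc ρ_c Lc`, contact symbol `γ · ctGen 3 α Lc`
at level `j` — every side condition of the propagator DISCHARGED (rules 1–4, reflection invariance, spread, `E`-commutation of diagonal kernels,
the summability and localisation of the dressed generator) and the coarse generator symbols REWRITTEN as `(γ/(stepScale j·Lc⁴)) · ctGen 3 α Lc`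
of the next level (`mmSym_dressedGen_inl` + `conjW_mmRead_diag_congr`); what stays hypothesis is table data only (the three sharp laws at
level `j`, localisations).  The assembly with the border sector `(cB·wB2) • vh₂S` and the units locks (part 3b) is not here.
Provenance: β sub-cell, unit beta-an2 gen 18, 2026-08-20 (v1); no existing file touched.
-/

open Finset
open scoped BigOperators
open Literature.MathematicalPhysics.QuantumFieldTheory.Balaban1983to89
open Literature.MathematicalPhysics.QuantumFieldTheory.Balaban1983to89.Beta
open ExpKernelCalculus (MKer Decays BiLoc comp)
open PolarizationSign (reflSign)
open KernelReflection (refK)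
open ResolventReflection (bref Φ)
open OneStepResolventKernel (Fib)
open OneStepKernelFamily (colH)
open BalabanStepJetsSucc (mmRead)
open SecondOrderResponse (dM K2OfK)
open BalabanStepW2 (K3OfK)
open Summit.QuantumFields.BalabanUV.Beta.TameKernelCalculus
open Summit.QuantumFields.BalabanUV.Beta.ChartConjugation (conjV conjW loc_conjW)
open Summit.QuantumFields.BalabanUV.Beta.ChartConjugationRelative (RelInv)
open Summit.QuantumFields.BalabanUV.Beta.BorderedHessian (diagK)
open Summit.QuantumFields.BalabanUV.Beta.WardLocusCubic (mmSym)
open Summit.QuantumFields.BalabanUV.Beta.SecondOrderContactForm (dM_table_sharp_split)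
open Summit.QuantumFields.BalabanUV.Beta.SecondOrderStepTransport (mmRead_K3OfK_bref_sharp)
open Summit.QuantumFields.BalabanUV.Beta.SecondOrderContactMmRead (mmRead_K3OfK_sharp_split conjW_mmRead_diag_congr mmSym_dressedGen_inl mmSym_inl)
open OneStepResolventKernel (LocStencil)
open OneStepKernelFamily (KInvStep)
open AffineAveraging (box toSite)
open AveragingContoursRooted (ctr ctrOff ctrOff_mem_box)
open Summit.QuantumFields.BalabanUV.Beta.AxialDressingRooted (coDressKBmAt axEc spr_axEc refK_coDressKBmAt_KInvStep decays_coDressKBmAt_KInvStep)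
open Summit.QuantumFields.BalabanUV.Beta.BorderedHessian (ctGen comp_axEc_diagK_comm bhKStepAt stepScale stepScale_ne_zero
  relInv_coDressKBmAt_KInvStep_bhKStepAt spr_bhKStepAt)
open Summit.QuantumFields.BalabanUV.Beta.VertexReflectionContact (smul_diagK summable_colH_mul_ctGen summable_colH_mul_of_locStencil)
open Summit.QuantumFields.BalabanUV.Beta.E3CoDressedContact (loc_diagK_dressedGen)
open Summit.QuantumFields.BalabanUV.Beta.SpineRooted (bhKStepAt_mf_uniform bhKStepAt_mm_uniform spr_stepProp)

namespace Summit.QuantumFields.BalabanUV.Beta.SecondOrderStepEval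

noncomputable section

variable {d N : ℕ} [NeZero N]

/-- [folklore] **THE REFLECTION LAW OF THE NEXT LEVEL'S FIELD–FIELD SECOND-ORDER TABLE, EVALUATED** (see the module docstring). -/
theorem mmRead_K3OfK_bref_sharp_split (N' : ℕ) {K 𝕄 E : MKer (d + 1) (Fib d)} {α : Fin (d + 1)} (hK : refK (Φ N α) K = K)
    (hKs : Spr K) (h𝕄 : Spr 𝕄) (hE : Spr E) (hR : RelInv K 𝕄 E)
    {S M : Fin (d + 1) → (Fin (d + 1) → ℤ) → MKer (d + 1) (Fib d)}
    {g : Fin (d + 1) → (Fin (d + 1) → ℤ) → (Fin (d + 1) → ℤ) → Fib d → ℝ}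
    {W R : Fin (d + 1) → (Fin (d + 1) → ℤ) → Fin (d + 1) → (Fin (d + 1) → ℤ) → MKer (d + 1) (Fib d)}
    {h : Fin (d + 1) → (Fin (d + 1) → ℤ) → Fin (d + 1) → (Fin (d + 1) → ℤ) → (Fin (d + 1) → ℤ) → Fib d → ℝ}
    (hS : ∀ κ u, S κ (bref α κ u) = reflSign α κ • refK (Φ N α) (S κ u + conjV 𝕄 (diagK (g κ u))))
    (hM : ∀ ρ w, M ρ (bref α ρ w) = reflSign α ρ • refK (Φ N α) (M ρ w))
    (hW : ∀ μ y ν y', W μ (bref α μ y) ν (bref α ν y') = (reflSign α μ * reflSign α ν) • refK (Φ N α)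
      (W μ y ν y' + conjW 𝕄 (dM K N S M μ y) (dM K N S M ν y') (diagK fun p c => ∑ κ, ∑' u, colH K N μ y κ u * g κ u p c)
        (diagK fun p c => ∑ κ, ∑' u, colH K N ν y' κ u * g κ u p c) (diagK (h μ y ν y')) + R μ y ν y'))
    (hSs : ∀ (μ : Fin (d + 1)) (y : Fin (d + 1) → ℤ) (κ : Fin (d + 1)) (x z : Fin (d + 1) → ℤ) (a b : Fib d),
      Summable fun u => colH K N μ y κ u * S κ u x z a b)
    (hg : ∀ (μ : Fin (d + 1)) (y : Fin (d + 1) → ℤ) (κ : Fin (d + 1)) (p : Fin (d + 1) → ℤ) (c : Fib d),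
      Summable fun u => colH K N μ y κ u * g κ u p c)
    (hD : ∀ ν y', Loc (dM K N S M ν y')) (hWl : ∀ μ y ν y', Loc (W μ y ν y')) (hRl : ∀ μ y ν y', Loc (R μ y ν y'))
    (hGl : ∀ μ y, Loc (diagK fun p c => ∑ κ, ∑' u, colH K N μ y κ u * g κ u p c)) (hhl : ∀ μ y ν y', Loc (diagK (h μ y ν y')))
    (hEG : ∀ μ y, comp E (diagK fun p c => ∑ κ, ∑' u, colH K N μ y κ u * g κ u p c) = comp (diagK fun p c => ∑ κ, ∑' u, colH K N μ y κ u * g κ u p c) E)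
    (hEh : ∀ μ y ν y', comp E (diagK (h μ y ν y')) = comp (diagK (h μ y ν y')) E)
    (μ : Fin (d + 1)) (y : Fin (d + 1) → ℤ) (ν : Fin (d + 1)) (y' : Fin (d + 1) → ℤ) :
    mmRead N (K3OfK K N S M W μ (bref α μ y) ν (bref α ν y')) =
      (reflSign α μ * reflSign α ν) • refK (Φ (d := d) N' α)
        (mmRead N (K3OfK K N S M W μ y ν y') +
          conjW (mmRead N K) (mmRead N (K2OfK K N S M μ y)) (mmRead N (K2OfK K N S M ν y'))
            (diagK (mmSym N fun p c => ∑ κ, ∑' u, colH K N μ y κ u * g κ u p c))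
            (diagK (mmSym N fun p c => ∑ κ, ∑' u, colH K N ν y' κ u * g κ u p c)) (diagK (mmSym N (h μ y ν y'))) -
          mmRead N (comp (comp K (R μ y ν y')) K)) := by
  -- the ♯-tables as families, and the localisation of `dM K N S♯ M ·`
  have hD' : ∀ ν y', Loc (dM K N (fun κ u => S κ u + conjV 𝕄 (diagK (g κ u))) M ν y') := fun ν y' => by
    rw [dM_table_sharp_split N 𝕄 K S M ν y' (hSs ν y') hg]
    exact (hD ν y').add (ChartConjugation.loc_conjV h𝕄 (hGl ν y'))
  have hWl' : ∀ μ y ν y', Loc (W μ y ν y' +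
      conjW 𝕄 (dM K N S M μ y) (dM K N S M ν y') (diagK fun p c => ∑ κ, ∑' u, colH K N μ y κ u * g κ u p c)
        (diagK fun p c => ∑ κ, ∑' u, colH K N ν y' κ u * g κ u p c) (diagK (h μ y ν y')) + R μ y ν y') := fun μ y ν y' =>
    ((hWl μ y ν y').add (loc_conjW h𝕄 (hD μ y) (hD ν y') (hGl μ y) (hGl ν y') (hhl μ y ν y'))).add (hRl μ y ν y')
  rw [mmRead_K3OfK_bref_sharp N' hK hKs hS hM
      (Wg := fun μ y ν y' => W μ y ν y' +
        conjW 𝕄 (dM K N S M μ y) (dM K N S M ν y') (diagK fun p c => ∑ κ, ∑' u, colH K N μ y κ u * g κ u p c)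
          (diagK fun p c => ∑ κ, ∑' u, colH K N ν y' κ u * g κ u p c) (diagK (h μ y ν y')) + R μ y ν y')
      hW hD' hWl' μ y ν y',
    mmRead_K3OfK_sharp_split hKs h𝕄 hE hR μ y ν y' hSs hg (hD μ y) (hD ν y') (hWl μ y ν y') (hRl μ y ν y') (hGl μ y) (hGl ν y')
      (hhl μ y ν y') (hEG μ y) (hEG ν y') (hEh μ y ν y')]

/-! ## The wall's level-`j` propagator: every propagator-side condition discharged -/

section Wall

variable {Lc : ℕ} [NeZero Lc]

/-- [folklore] The `γ`-scaled dressed generator symbol is `γ ·` the dressed generator symbol (termwise `tsum_mul_left`). -/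
theorem dressedGen_smul_eq (K : MKer (d + 1) (Fib d)) (N L : ℕ) (γ : ℝ) (α μ : Fin (d + 1)) (y : Fin (d + 1) → ℤ) :
    (fun p c => ∑ κ, ∑' u, colH K N μ y κ u * (γ * ctGen d α L κ u p c)) =
      fun p c => γ * ∑ κ, ∑' u, colH K N μ y κ u * ctGen d α L κ u p c := by
  funext p c
  rw [Finset.mul_sum]
  refine Finset.sum_congr rfl fun κ _ => ?_
  rw [← tsum_mul_left]
  exact tsum_congr fun u => by ring

/-- [folklore] **THE EVALUATED LAW FOR THE WALL'S LEVEL-`j` PROPAGATOR** (`d + 1 = 4`, odd `Lc`, centred root; see the module docstring):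
only TABLE data is hypothesis — the three sharp laws at level `j` (first order with contact symbol `γ · ctGen 3 α Lc` against `bhKStepAt 3 ρ_c Lc j`,
second order of similarity shape up to the remainder `R`), a localisation rate of `S`, and the localisations of `dM`, `W`, `R`, `diagK h`. -/
theorem mmRead_K3OfK_stepProp_bref (hLc : Odd Lc) (j : ℕ) (γ : ℝ) {α : Fin 4}
    {S M : Fin 4 → (Fin 4 → ℤ) → MKer 4 (Fib 3)} {W R : Fin 4 → (Fin 4 → ℤ) → Fin 4 → (Fin 4 → ℤ) → MKer 4 (Fib 3)}
    {h : Fin 4 → (Fin 4 → ℤ) → Fin 4 → (Fin 4 → ℤ) → (Fin 4 → ℤ) → Fib 3 → ℝ}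
    (hS : ∀ κ u, S κ (bref α κ u) = reflSign α κ • refK (Φ Lc α)
      (S κ u + conjV (bhKStepAt 3 (toSite (ctrOff 4 Lc)) Lc j) (diagK fun p c => γ * ctGen 3 α Lc κ u p c)))
    (hM : ∀ ρ w, M ρ (bref α ρ w) = reflSign α ρ • refK (Φ Lc α) (M ρ w))
    (hW : ∀ μ y ν y', W μ (bref α μ y) ν (bref α ν y') = (reflSign α μ * reflSign α ν) • refK (Φ Lc α)
      (W μ y ν y' +
        conjW (bhKStepAt 3 (toSite (ctrOff 4 Lc)) Lc j)
          (dM (coDressKBmAt (toSite (ctrOff 4 Lc)) Lc (KInvStep (d := 3) Lc j)) Lc S M μ y)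
          (dM (coDressKBmAt (toSite (ctrOff 4 Lc)) Lc (KInvStep (d := 3) Lc j)) Lc S M ν y')
          (diagK fun p c => ∑ κ, ∑' u, colH (coDressKBmAt (toSite (ctrOff 4 Lc)) Lc (KInvStep (d := 3) Lc j)) Lc μ y κ u * (γ * ctGen 3 α Lc κ u p c))
          (diagK fun p c => ∑ κ, ∑' u, colH (coDressKBmAt (toSite (ctrOff 4 Lc)) Lc (KInvStep (d := 3) Lc j)) Lc ν y' κ u * (γ * ctGen 3 α Lc κ u p c))
          (diagK (h μ y ν y')) + R μ y ν y'))
    (hSl : ∃ Cs δ : ℝ, 0 < δ ∧ LocStencil S Cs δ)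
    (hD : ∀ ν y', Loc (dM (coDressKBmAt (toSite (ctrOff 4 Lc)) Lc (KInvStep (d := 3) Lc j)) Lc S M ν y'))
    (hWl : ∀ μ y ν y', Loc (W μ y ν y')) (hRl : ∀ μ y ν y', Loc (R μ y ν y')) (hhl : ∀ μ y ν y', Loc (diagK (h μ y ν y')))
    (μ : Fin 4) (y : Fin 4 → ℤ) (ν : Fin 4) (y' : Fin 4 → ℤ) :
    mmRead Lc (K3OfK (coDressKBmAt (toSite (ctrOff 4 Lc)) Lc (KInvStep (d := 3) Lc j)) Lc S M W μ (bref α μ y) ν (bref α ν y')) =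
      (reflSign α μ * reflSign α ν) • refK (Φ (d := 3) Lc α)
        (mmRead Lc (K3OfK (coDressKBmAt (toSite (ctrOff 4 Lc)) Lc (KInvStep (d := 3) Lc j)) Lc S M W μ y ν y') +
          conjW (mmRead Lc (coDressKBmAt (toSite (ctrOff 4 Lc)) Lc (KInvStep (d := 3) Lc j)))
            (mmRead Lc (K2OfK (coDressKBmAt (toSite (ctrOff 4 Lc)) Lc (KInvStep (d := 3) Lc j)) Lc S M μ y))
            (mmRead Lc (K2OfK (coDressKBmAt (toSite (ctrOff 4 Lc)) Lc (KInvStep (d := 3) Lc j)) Lc S M ν y'))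
            (diagK fun p c => γ / (stepScale 3 Lc j * (Lc : ℝ) ^ 4) * ctGen 3 α Lc μ y p c)
            (diagK fun p c => γ / (stepScale 3 Lc j * (Lc : ℝ) ^ 4) * ctGen 3 α Lc ν y' p c) (diagK (mmSym Lc (h μ y ν y'))) -
          mmRead Lc (comp (comp (coDressKBmAt (toSite (ctrOff 4 Lc)) Lc (KInvStep (d := 3) Lc j)) (R μ y ν y'))
            (coDressKBmAt (toSite (ctrOff 4 Lc)) Lc (KInvStep (d := 3) Lc j)))) := by
  have hL1 : 1 ≤ Lc := hLc.pos
  have hr := ctrOff_mem_box (d := 4) hL1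
  set G := coDressKBmAt (toSite (ctrOff 4 Lc)) Lc (KInvStep (d := 3) Lc j) with hG
  have hKs : Spr G := spr_stepProp hr j
  have hKd : ∃ δ C : ℝ, 0 < δ ∧ 0 ≤ C ∧ Decays G C δ := decays_coDressKBmAt_KInvStep (d := 3) hr j
  have h𝕄 : Spr (bhKStepAt 3 (toSite (ctrOff 4 Lc)) Lc j) := spr_bhKStepAt hr j
  have hRel := relInv_coDressKBmAt_KInvStep_bhKStepAt (d := 3) (Lc := Lc) hr j
  obtain ⟨Cs, δs, hδs, hSloc⟩ := hSl
  -- the dressed generator: summability, localisation, `E`-commutation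
  have hg : ∀ (μ : Fin 4) (y : Fin 4 → ℤ) (κ : Fin 4) (p : Fin 4 → ℤ) (c : Fib 3),
      Summable fun u => colH G Lc μ y κ u * (γ * ctGen 3 α Lc κ u p c) := fun μ y κ p c =>
    ((summable_colH_mul_ctGen (N := Lc) hKd hL1 α μ y κ p c).mul_left γ).congr fun u => by ring
  have hGl : ∀ (μ : Fin 4) (y : Fin 4 → ℤ), Loc (diagK fun p c => ∑ κ, ∑' u, colH G Lc μ y κ u * (γ * ctGen 3 α Lc κ u p c)) := fun μ y => by
    rw [dressedGen_smul_eq, ← smul_diagK]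
    exact (loc_diagK_dressedGen hKs α μ y).smul γ
  rw [mmRead_K3OfK_bref_sharp_split (N := Lc) Lc (refK_coDressKBmAt_KInvStep (d := 3) hLc j α) hKs h𝕄 (spr_axEc _ _) hRel hS hM hW
      (fun μ y κ x z a b => summable_colH_mul_of_locStencil hKd hSloc hδs μ y κ x z a b) hg hD hWl hRl hGl hhl
      (fun μ y => comp_axEc_diagK_comm _ _ _) (fun μ y ν y' => comp_axEc_diagK_comm _ _ _) μ y ν y',
    conjW_mmRead_diag_congr Lc (g₁ := fun p c => γ / (stepScale 3 Lc j * (Lc : ℝ) ^ 4) * ctGen 3 α Lc μ y p c)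
      (g₁' := fun p c => γ / (stepScale 3 Lc j * (Lc : ℝ) ^ 4) * ctGen 3 α Lc ν y' p c) (h₁ := mmSym Lc (h μ y ν y')) _ _ _
      (fun x m => mmSym_dressedGen_inl hL1 hKs (stepScale 3 Lc j) (stepScale_ne_zero j) (bhKStepAt_mf_uniform _ j)
        (bhKStepAt_mm_uniform _ j) hRel.EMA γ α μ y x m)
      (fun x m => mmSym_dressedGen_inl hL1 hKs (stepScale 3 Lc j) (stepScale_ne_zero j) (bhKStepAt_mf_uniform _ j)
        (bhKStepAt_mm_uniform _ j) hRel.EMA γ α ν y' x m)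
      (fun x m => rfl)]

end Wall

end

end Summit.QuantumFields.BalabanUV.Beta.SecondOrderStepEval
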